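/-
Lead `ym-line-sgb-p2` (gen 1, seat prover-ym-line-sgb-p2-g1-0), route `SteinGapBootstrap`, crux item
stmt-QuantumFields-23800 `UProbeCovFromPairLaw` ≡ stmt-QuantumFields-23640 `ProbeCovFromPairLawG`, line `direct`,
STUB `stub_axisProbe` (lattice side, pointwise).
-/
import Summits.QuantumFields.YangMills.Theorems.SteinGapBootstrapProbeCovFromPairLawGAxis
import Summits.QuantumFields.YangMills.Theorems.EquipartitionCriticalityEquipartitionPinsProbeTangentTangentDefect
import HarnessLib

/-!
# Route `SteinGapBootstrap`, crux `UProbeCovFromPairLaw` (stmt-QuantumFields-23800 ≡ `ProbeCovFromPairLawG` 23640),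
# line `direct`: STUB `stub_axisProbe` — the lattice side, pointwise

NOT THE CLAY GAP: the route bears on the RECORD-label rung leaf R2ξ′ `WeakCouplingRates.XiPow`; this file proves a
deterministic comb-gauge estimate and no summit statement.

The registered stub asks for the pointwise comparison `|exp(−2(βE)₊) − exp(−Σ_a (Y^β_{(x;1,2)})_a²)| ≤ K √β E`,
`E = N − Re tr ρ(U_{(x;1,2)})`, at every site `x` with `x₂ = x₃ = 0` (a hypothesis slightly weaker than "on the time
axis": the comb structure of the plaquette `(x; 1, 2)` only reads the coordinates `2, 3`). The width seat's landed file
`SteinGapBootstrapProbeCovFromPairLawGAxis` proves the same chain for `x₁ = x₂ = x₃ = 0`; here the three comb-gauge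
identities are re-run under the weaker hypothesis (their proofs use nothing else) and the real-variable core
`ProbeCovFromPairLaw.abs_exp_sub_exp_le_sqrt` and the chart constant `stub_tangentDefect` are reused.

References: S. Chatterjee, arXiv:1602.01222 §§9, 11 [arXiv160201222]; J. von Neumann, Math. Z. 30 (1929) 3, §3
[vonNeumann1929].
-/

set_option autoImplicit false

noncomputable section

namespace Summit.QuantumFields.YangMills.Theorems.SteinGapBootstrap

namespace ProbeCovDirect

open MeasureTheory
open Literature.Probability.LatticeModels Literature.MathematicalPhysics.QuantumLattice
  Literature.MathematicalPhysics.QuantumFieldTheory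
open Summit.QuantumFields.YangMills.Theorems.EquipartitionPinsProbe

section Comb

variable {G : Type} [Group G]

/-- `Ũ_{(x;1,2)} = Ũ_{(x+e₂,1)}⁻¹` whenever `x₂ = x₃ = 0`: the links `(x,1)`, `(x+e₁,2)`, `(x,2)` are comb edges.
[cite: arXiv160201222, §9] -/
theorem holonomy_axialFix_12 (U : LGConfig 4 G) {x : Site 4} (hx : ∀ j : Fin 4, 1 < j → x j = 0) :
    plaquetteHolonomyZd (axialFix U) x 1 2 = (axialFix U (x + Pi.single 2 1, 1))⁻¹ := by
  have h12 : (1 : Fin 4) < 2 := by decide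
  have hz : ∀ k' : Fin 4, 2 < k' → x k' = 0 := fun k' hk' => hx k' (lt_trans h12 hk')
  rw [TangentCombPoincare.holonomy_axialFix_of_top U h12 hz, CombBasics.axialFix_of_isComb U hx, one_mul]

variable [TopologicalSpace G] (r : LatticeRep G)

/-- For `x₂ = x₃ = 0` the rescaled comb-gauge plaquette field at `(x; 1, 2)` is
`Y^a = -√β · Re tr((ρ(Ũ_{(x+e₂,1)}) − 1) e_a†)` exactly. [cite: arXiv160201222, §9] -/
theorem plaqField_12 (β : ℝ) (U : LGConfig 4 G) {x : Site 4} (hx : ∀ j : Fin 4, 1 < j → x j = 0)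
    (a : Fin (lieDim r)) :
    plaqField r β U (plaquette12 (d := 4) (by norm_num) x) a =
      -(Real.sqrt β * lieCoord r (r.ρ (axialFix U (x + Pi.single 2 1, 1)) - 1) a) := by
  have h1 : linkField r β U (x, 1) a = 0 := ProbeCovFromPairLaw.linkField_of_isComb r β U hx a
  have h2 : linkField r β U (x + Pi.single 1 1, 2) a = 0 :=
    ProbeCovFromPairLaw.linkField_of_isComb r β U (fun j' hj' => by
      rw [Pi.add_apply, hx j' (lt_trans (by decide) hj'), Pi.single_eq_of_ne (ne_of_gt (lt_trans (by decide) hj')),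
        add_zero]) a
  have h3 : linkField r β U (x, 2) a = 0 :=
    ProbeCovFromPairLaw.linkField_of_isComb r β U (fun j' hj' => hx j' (lt_trans (by decide) hj')) a
  rw [plaqField, plaquetteCurl_eq]
  show linkField r β U (x, 1) a + linkField r β U (x + Pi.single 1 1, 2) a -
      linkField r β U (x + Pi.single 2 1, 1) a - linkField r β U (x, 2) a = _
  rw [h1, h2, h3, zero_add, sub_zero, zero_sub, linkField]

/-- For `x₂ = x₃ = 0`: `N − Re tr ρ(U_{(x;1,2)}) = N − Re tr ρ(Ũ_{(x+e₂,1)})`. [cite: arXiv160201222, §9] -/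
theorem energy_12 (U : LGConfig 4 G) {x : Site 4} (hx : ∀ j : Fin 4, 1 < j → x j = 0) :
    (r.N : ℝ) - plaquetteObs r.ρ x 1 2 U = (r.N : ℝ) - (r.ρ (axialFix U (x + Pi.single 2 1, 1))).trace.re := by
  rw [← TangentEnergyLaw.re_trace_holonomy_axialFix r.ρ U x 1 2, holonomy_axialFix_12 U hx,
    TangentCombPoincare.re_trace_map_inv r.ρ r.mem_unitary]

/-- For `x₂ = x₃ = 0`, `β ≥ 0` and the chart constant `K`: `|Y|² ≤ 2βE` and `2βE − |Y|² ≤ KβE²` at `(x; 1, 2)`.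
[cite: vonNeumann1929, §3] -/
theorem tangent_12 [CompactSpace G] {K : ℝ}
    (hK : ∀ g : G, 0 ≤ 2 * ((r.N : ℝ) - (r.ρ g).trace.re) - ∑ a, (lieCoord r (r.ρ g - 1) a) ^ 2 ∧
      2 * ((r.N : ℝ) - (r.ρ g).trace.re) - ∑ a, (lieCoord r (r.ρ g - 1) a) ^ 2 ≤ K * ((r.N : ℝ) - (r.ρ g).trace.re) ^ 2)
    {β : ℝ} (hβ : 0 ≤ β) (U : LGConfig 4 G) {x : Site 4} (hx : ∀ j : Fin 4, 1 < j → x j = 0) :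
    ∑ a, (plaqField r β U (plaquette12 (d := 4) (by norm_num) x) a) ^ 2 ≤
        2 * (β * ((r.N : ℝ) - plaquetteObs r.ρ x 1 2 U)) ∧
      2 * (β * ((r.N : ℝ) - plaquetteObs r.ρ x 1 2 U)) -
          ∑ a, (plaqField r β U (plaquette12 (d := 4) (by norm_num) x) a) ^ 2 ≤
        K * β * ((r.N : ℝ) - plaquetteObs r.ρ x 1 2 U) ^ 2 := by
  set g : G := axialFix U (x + Pi.single 2 1, 1) with hg
  have hY : ∀ a, (plaqField r β U (plaquette12 (d := 4) (by norm_num) x) a) ^ 2 =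
      β * (lieCoord r (r.ρ g - 1) a) ^ 2 := fun a => by
    rw [plaqField_12 r β U hx a, neg_sq, mul_pow, Real.sq_sqrt hβ]
  simp only [hY, ← Finset.mul_sum, energy_12 r U hx]
  obtain ⟨h0, h1⟩ := hK g
  constructor
  · nlinarith [mul_le_mul_of_nonneg_left h0 hβ]
  · nlinarith [mul_le_mul_of_nonneg_left h1 hβ]

end Comb

/-- STUB `stub_axisProbe` of line `direct` (crux stmt-QuantumFields-23800 ≡ 23640) — **lattice side, pointwise**: there
is `K ≥ 0` (the square root of the chart constant of `stub_tangentDefect`) with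
`|exp(−2(βE)₊) − exp(−Σ_a (Y^β_{(x;1,2)})_a²)| ≤ K √β E` for every `β > 0`, every `x` with `x₂ = x₃ = 0` and every `U`.
[cite: vonNeumann1929, §3] -/
theorem stub_axisProbe :
    ∀ (G : Type) [Group G] [TopologicalSpace G] [CompactSpace G]
      (r : Literature.MathematicalPhysics.QuantumFieldTheory.LatticeRep G), ∃ K : ℝ, 0 ≤ K ∧
      ∀ (β : ℝ), 0 < β → ∀ (x : Literature.Probability.LatticeModels.Site 4), (∀ j : Fin 4, 1 < j → x j = 0) →
        ∀ U : Literature.MathematicalPhysics.QuantumLattice.LGConfig 4 G,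
          |Real.exp (-2 * max (β * ((r.N : ℝ) - Literature.MathematicalPhysics.QuantumLattice.plaquetteObs r.ρ x 1 2 U)) 0) -
              Real.exp (-(∑ a : Fin (Summit.QuantumFields.YangMills.Theorems.EquipartitionPinsProbe.lieDim r),
                (Summit.QuantumFields.YangMills.Theorems.EquipartitionPinsProbe.plaqField r β U
                  (Literature.MathematicalPhysics.QuantumFieldTheory.plaquette12 (d := 4) (by norm_num) x) a) ^ 2))| ≤
            K * Real.sqrt β * ((r.N : ℝ) - Literature.MathematicalPhysics.QuantumLattice.plaquetteObs r.ρ x 1 2 U) := by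
  intro G _ _ _ r
  obtain ⟨K₀, hK₀⟩ := stub_tangentDefect G r
  -- the chart constant may be taken non-negative
  have hK : ∀ g : G, 0 ≤ 2 * ((r.N : ℝ) - (r.ρ g).trace.re) - ∑ a, (lieCoord r (r.ρ g - 1) a) ^ 2 ∧
      2 * ((r.N : ℝ) - (r.ρ g).trace.re) - ∑ a, (lieCoord r (r.ρ g - 1) a) ^ 2 ≤
        max K₀ 0 * ((r.N : ℝ) - (r.ρ g).trace.re) ^ 2 := fun g =>
    ⟨(hK₀ g).1, (hK₀ g).2.trans (mul_le_mul_of_nonneg_right (le_max_left _ _) (sq_nonneg _))⟩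
  refine ⟨Real.sqrt (max K₀ 0), Real.sqrt_nonneg _, fun β hβ x hx U => ?_⟩
  set E : ℝ := (r.N : ℝ) - plaquetteObs r.ρ x 1 2 U with hE
  have hE0 : 0 ≤ E := TangentPlaquetteEnergy.sub_plaquetteObs_nonneg r.ρ r.mem_unitary x 1 2 U
  have hβE : 0 ≤ β * E := mul_nonneg hβ.le hE0
  obtain ⟨h1, h2⟩ := tangent_12 r hK hβ.le U hx
  have hP : Real.exp (-2 * max (β * E) 0) = Real.exp (-(2 * (β * E))) := by
    rw [max_eq_left hβE]; ring_nf
  rw [hP]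
  refine le_trans (ProbeCovFromPairLaw.abs_exp_sub_exp_le_sqrt (Finset.sum_nonneg fun a _ => sq_nonneg _) h1 h2)
    (le_of_eq ?_)
  rw [show max K₀ 0 * β * E ^ 2 = (max K₀ 0 * β) * E ^ 2 by ring, Real.sqrt_mul' _ (sq_nonneg E), Real.sqrt_sq hE0,
    Real.sqrt_mul (le_max_right _ _)]

end ProbeCovDirect

end Summit.QuantumFields.YangMills.Theorems.SteinGapBootstrap

end
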